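import Summits.ValiantsHypothesis.ValiantsHypothesis.Theorems.NewtonTauWeak.Negative.AlignedPeelingSumset

/-!
# `NewtonTauWeak` (stmt-5904), line `aligned-peeling` refuted — part 2a: the corner lemma (negative lane)

The series `Theorems/NewtonTauWeak/Negative/AlignedPeeling*.lean` refutes the load-bearing stub `stub_alignedPeeling`
(`∃ C c, AlignedPeeling C c`) of the registered line `aligned-peeling` of crux `NewtonTauWeak`
(stmt-ValiantsHypothesis-5904); see `AlignedPeelingSumset.lean` for the overview.  The LINE dies; the crux itself
stays OPEN; nothing here bears on `VP ≠ VNP`.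

This file: `corner_uniqueMin` — for finite exponent sets `T₀,…,T_{ℓ-1}` (`ℓ ≥ 2`) all containing a corner `c`
and two further points `a, b` spanning a cone at `c` that contains every `T_i`, a point that is the UNIQUE minimiser
of a real form over the sumset MINUS its summit `ℓ•c` is either the unique minimiser over the whole sumset, or the
summit displaced by the unique cheapest single-factor deviation (`(ℓ-1)•c + t`, `t` the unique minimiser of the form
over the union of the `T_i ∖ {c}`, the form being larger there than at `c`).  The tie case is excluded by exhibiting
three collinear minimisers.  [folklore]
-/

set_option linter.dupNamespace false

namespace Summit.ValiantsHypothesis.ValiantsHypothesis.Theorems.NewtonTauWeak.Negative.AlignedPeelingCex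

open scoped BigOperators
open MvPolynomial Finset
open Summit.ValiantsHypothesis.ValiantsHypothesis.Theorems.NewtonTauWeak.Negative (vert)

noncomputable section

/-! ## B.1 The corner lemma: unique minimisers over a sumset minus a summit -/

/-- A point of the sumset built from the constant choice except at one index. -/
theorem update_sum_eq {ℓ : ℕ} (c t : Fin 2 →₀ ℕ) (i : Fin ℓ) :
    ∑ j, Function.update (fun _ : Fin ℓ => c) i t j = (ℓ - 1) • c + t := by
  classical
  rw [Finset.sum_update_of_mem (Finset.mem_univ i), Finset.sum_const, add_comm]
  congr 2
  rw [Finset.card_univ_sdiff, Fintype.card_fin, Finset.card_singleton]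

/-- `(ℓ-1)•c + t` lies in the sumset when every factor contains `c` and some factor contains `t`. -/
theorem devPoint_mem_sumset {ℓ : ℕ} (T : Fin ℓ → Finset (Fin 2 →₀ ℕ)) (c t : Fin 2 →₀ ℕ)
    (hc : ∀ i, c ∈ T i) (i : Fin ℓ) (ht : t ∈ T i) : (ℓ - 1) • c + t ∈ sumset T := by
  classical
  rw [← update_sum_eq c t i]
  refine sum_mem_sumset T _ fun j => ?_
  rcases eq_or_ne j i with rfl | hji
  · simpa using ht
  · simp [Function.update_of_ne hji, hc j]

/-- The summit `ℓ • c` lies in the sumset when every factor contains `c`. -/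
theorem summit_mem_sumset {ℓ : ℕ} (T : Fin ℓ → Finset (Fin 2 →₀ ℕ)) (c : Fin 2 →₀ ℕ) (hc : ∀ i, c ∈ T i) :
    ℓ • c ∈ sumset T := by
  have h := sum_mem_sumset T (fun _ => c) hc
  simpa using h

/-- Cancellation: `(ℓ-1)•c + t = ℓ•c` forces `t = c` (for `ℓ ≥ 1`). -/
theorem eq_of_devPoint_eq_summit {ℓ : ℕ} (hℓ : 1 ≤ ℓ) {c t : Fin 2 →₀ ℕ} (h : (ℓ - 1) • c + t = ℓ • c) :
    t = c := by
  have h' : ℓ • c = (ℓ - 1) • c + c := by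
    conv_lhs => rw [show ℓ = (ℓ - 1) + 1 by omega]
    rw [add_nsmul, one_nsmul]
  rw [h'] at h
  exact add_left_cancel h

/-- **Corner lemma.**  `T₀,…,T_{ℓ-1}` (`ℓ ≥ 2`) all contain `c`, `a`, `b` and lie in the cone at `c` spanned by
`a - c`, `b - c`.  If `x` is the unique minimiser of a real form over the sumset MINUS the summit `ℓ•c`, then either `x`
is the unique minimiser over the whole sumset, or `x = (ℓ-1)•c + t` where `t` is the unique minimiser of the form over
the union `U` of the `T_i ∖ {c}` and the form is strictly larger on `U` than at `c`. [folklore] -/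
theorem corner_uniqueMin {ℓ : ℕ} (hℓ : 2 ≤ ℓ) (T : Fin ℓ → Finset (Fin 2 →₀ ℕ)) (c a b : Fin 2 →₀ ℕ)
    (hac : a ≠ c) (hbc : b ≠ c) (hc : ∀ i, c ∈ T i) (ha : ∀ i, a ∈ T i) (hb : ∀ i, b ∈ T i)
    (hcone : ∀ i, ∀ t ∈ T i, ∃ α β : ℝ, 0 ≤ α ∧ 0 ≤ β ∧
        ((t 0 : ℝ) - c 0 = α * ((a 0 : ℝ) - c 0) + β * ((b 0 : ℝ) - c 0)) ∧
        ((t 1 : ℝ) - c 1 = α * ((a 1 : ℝ) - c 1) + β * ((b 1 : ℝ) - c 1)))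
    (ξ₀ ξ₁ : ℝ) (x : Fin 2 →₀ ℕ) (hx : IsUniqueMin ξ₀ ξ₁ ((sumset T).erase (ℓ • c)) x) :
    IsUniqueMin ξ₀ ξ₁ (sumset T) x ∨
    ∃ t ∈ Finset.univ.biUnion (fun i => (T i).erase c), x = (ℓ - 1) • c + t ∧
      IsUniqueMin ξ₀ ξ₁ (Finset.univ.biUnion fun i => (T i).erase c) t ∧
      ∀ t' ∈ Finset.univ.biUnion (fun i => (T i).erase c), fv ξ₀ ξ₁ c < fv ξ₀ ξ₁ t' := by
  classical
  have hℓ1 : 1 ≤ ℓ := by omega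
  set S := sumset T with hS
  set C := ℓ • c with hCdef
  set U := Finset.univ.biUnion (fun i => (T i).erase c) with hU
  obtain ⟨hxA, hxmin⟩ := hx
  have hxS : x ∈ S := Finset.mem_of_mem_erase hxA
  have hxC : x ≠ C := Finset.ne_of_mem_erase hxA
  have hCS : C ∈ S := summit_mem_sumset T c hc
  have hfvC : fv ξ₀ ξ₁ C = ℓ * fv ξ₀ ξ₁ c := fv_nsmul ξ₀ ξ₁ ℓ c
  have hcast : ((ℓ - 1 : ℕ) : ℝ) = (ℓ : ℝ) - 1 := by
    rw [Nat.cast_sub hℓ1, Nat.cast_one]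
  have hfvdev : ∀ t, fv ξ₀ ξ₁ ((ℓ - 1) • c + t) = ((ℓ : ℝ) - 1) * fv ξ₀ ξ₁ c + fv ξ₀ ξ₁ t := by
    intro t; rw [fv_add, fv_nsmul, hcast]
  -- membership facts for `U`
  have hmemU : ∀ {t}, t ∈ U ↔ ∃ i, t ∈ T i ∧ t ≠ c := by
    intro t; simp only [hU, Finset.mem_biUnion, Finset.mem_univ, true_and, Finset.mem_erase]
    constructor
    · rintro ⟨i, hne, hti⟩; exact ⟨i, hti, hne⟩
    · rintro ⟨i, hti, hne⟩; exact ⟨i, hne, hti⟩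
  have hdevA : ∀ {t}, t ∈ U → (ℓ - 1) • c + t ∈ S.erase C := by
    intro t ht
    obtain ⟨i, hti, hne⟩ := hmemU.mp ht
    refine Finset.mem_erase.mpr ⟨fun h => hne (eq_of_devPoint_eq_summit hℓ1 h), ?_⟩
    exact devPoint_mem_sumset T c t hc i hti
  -- representation of `x`
  obtain ⟨f, hfpi, hfx⟩ := (mem_sumset_iff T x).mp hxS
  have hf : ∀ i, f i ∈ T i := Fintype.mem_piFinset.mp hfpi
  have hfvx : fv ξ₀ ξ₁ x = ∑ i, fv ξ₀ ξ₁ (f i) := by rw [← hfx, fv_sum]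
  obtain ⟨i₀, hi₀⟩ : ∃ i, f i ≠ c := by
    by_contra hall
    push Not at hall
    apply hxC
    rw [← hfx]
    have : f = fun _ => c := funext hall
    rw [this]
    simp [hCdef]
  rcases lt_trichotomy (fv ξ₀ ξ₁ C) (fv ξ₀ ξ₁ x) with hlt | heq | hgt
  · -- Case (a): the summit is the strict minimum; second-best analysis
    right
    have hpos : ∀ t' ∈ U, fv ξ₀ ξ₁ c < fv ξ₀ ξ₁ t' := by
      intro t' ht'
      have hmem := hdevA ht'
      have h1 : fv ξ₀ ξ₁ x ≤ fv ξ₀ ξ₁ ((ℓ - 1) • c + t') := by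
        rcases eq_or_ne ((ℓ - 1) • c + t') x with h | h
        · rw [h]
        · exact (hxmin _ hmem h).le
      have h2 : fv ξ₀ ξ₁ C < fv ξ₀ ξ₁ ((ℓ - 1) • c + t') := hlt.trans_le h1
      rw [hfvC, hfvdev] at h2
      nlinarith
    have hUne : U.Nonempty := ⟨a, hmemU.mpr ⟨⟨0, by omega⟩, ha _, hac⟩⟩
    obtain ⟨tm, htmU, htmmin⟩ := Finset.exists_min_image U (fv ξ₀ ξ₁) hUne
    -- `x` is at least the second-best value
    have hxge : ((ℓ : ℝ) - 1) * fv ξ₀ ξ₁ c + fv ξ₀ ξ₁ tm ≤ fv ξ₀ ξ₁ x := by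
      have hterm : ∀ i, 0 ≤ fv ξ₀ ξ₁ (f i) - fv ξ₀ ξ₁ c := by
        intro i
        rcases eq_or_ne (f i) c with h | h
        · rw [h]; simp
        · exact (sub_pos.mpr (hpos _ (hmemU.mpr ⟨i, hf i, h⟩))).le
      have hi₀ge : fv ξ₀ ξ₁ tm - fv ξ₀ ξ₁ c ≤ fv ξ₀ ξ₁ (f i₀) - fv ξ₀ ξ₁ c :=
        sub_le_sub_right (htmmin _ (hmemU.mpr ⟨i₀, hf i₀, hi₀⟩)) _
      have hsum : fv ξ₀ ξ₁ (f i₀) - fv ξ₀ ξ₁ c ≤ ∑ i, (fv ξ₀ ξ₁ (f i) - fv ξ₀ ξ₁ c) :=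
        Finset.single_le_sum (fun i _ => hterm i) (Finset.mem_univ i₀)
      have hsplit : ∑ i, (fv ξ₀ ξ₁ (f i) - fv ξ₀ ξ₁ c) = fv ξ₀ ξ₁ x - ℓ * fv ξ₀ ξ₁ c := by
        rw [Finset.sum_sub_distrib, ← hfvx, Finset.sum_const, Finset.card_univ, Fintype.card_fin,
          nsmul_eq_mul]
      linarith
    have htmA := hdevA htmU
    have hxeq : x = (ℓ - 1) • c + tm := by
      by_contra hne
      have := hxmin _ htmA (Ne.symm hne)
      rw [hfvdev] at this
      linarith
    refine ⟨tm, htmU, hxeq, ⟨htmU, fun t' ht' hne => ?_⟩, hpos⟩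
    have hne' : (ℓ - 1) • c + t' ≠ x := by
      rw [hxeq]; intro h; exact hne (add_left_cancel h)
    have := hxmin _ (hdevA ht') hne'
    rw [hxeq, hfvdev, hfvdev] at this
    linarith
  · -- Case (b2): a tie between the summit and `x` is impossible
    exfalso
    -- every factor value is ≥ the value at `c`
    have hge : ∀ i, ∀ t ∈ T i, fv ξ₀ ξ₁ c ≤ fv ξ₀ ξ₁ t := by
      intro i t ht
      by_contra hlt'
      push Not at hlt'
      have hne : t ≠ c := fun h => by rw [h] at hlt'; exact lt_irrefl _ hlt'
      have hmem := hdevA (hmemU.mpr ⟨i, ht, hne⟩)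
      have hval : fv ξ₀ ξ₁ ((ℓ - 1) • c + t) < fv ξ₀ ξ₁ C := by
        rw [hfvdev, hfvC]; nlinarith
      rcases eq_or_ne ((ℓ - 1) • c + t) x with h | h
      · rw [h] at hval; linarith
      · have := hxmin _ hmem h; linarith
    -- the deviating factor of `x` ties with `c`
    have htie : fv ξ₀ ξ₁ (f i₀) = fv ξ₀ ξ₁ c := by
      have hterm : ∀ i ∈ (Finset.univ : Finset (Fin ℓ)), 0 ≤ fv ξ₀ ξ₁ (f i) - fv ξ₀ ξ₁ c :=
        fun i _ => sub_nonneg.mpr (hge i _ (hf i))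
      have hsplit : ∑ i, (fv ξ₀ ξ₁ (f i) - fv ξ₀ ξ₁ c) = 0 := by
        rw [Finset.sum_sub_distrib, ← hfvx, Finset.sum_const, Finset.card_univ, Fintype.card_fin,
          nsmul_eq_mul, ← heq, hfvC, sub_self]
      have := (Finset.sum_eq_zero_iff_of_nonneg hterm).mp hsplit i₀ (Finset.mem_univ _)
      linarith
    obtain ⟨α, β, hα, hβ, h0, h1⟩ := hcone i₀ (f i₀) (hf i₀)
    have hva : 0 ≤ fv ξ₀ ξ₁ a - fv ξ₀ ξ₁ c := sub_nonneg.mpr (hge i₀ a (ha i₀))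
    have hvb : 0 ≤ fv ξ₀ ξ₁ b - fv ξ₀ ξ₁ c := sub_nonneg.mpr (hge i₀ b (hb i₀))
    have hdecomp : fv ξ₀ ξ₁ (f i₀) - fv ξ₀ ξ₁ c =
        α * (fv ξ₀ ξ₁ a - fv ξ₀ ξ₁ c) + β * (fv ξ₀ ξ₁ b - fv ξ₀ ξ₁ c) := by
      simp only [fv]
      have e0 : ξ₀ * (((f i₀) 0 : ℝ) - c 0) = ξ₀ * (α * ((a 0 : ℝ) - c 0) + β * ((b 0 : ℝ) - c 0)) := by
        rw [h0]
      have e1 : ξ₁ * (((f i₀) 1 : ℝ) - c 1) = ξ₁ * (α * ((a 1 : ℝ) - c 1) + β * ((b 1 : ℝ) - c 1)) := by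
        rw [h1]
      linarith
    -- three distinct minimisers from a tie direction
    have three : ∀ d : Fin 2 →₀ ℕ, d ≠ c → (∀ i, d ∈ T i) → fv ξ₀ ξ₁ d = fv ξ₀ ξ₁ c → False := by
      intro d hdc hd hfd
      have hxval : fv ξ₀ ξ₁ x = ℓ * fv ξ₀ ξ₁ c := by rw [← heq, hfvC]
      -- y₁ = (ℓ-1)•c + d
      have hy₁ := hdevA (hmemU.mpr ⟨⟨0, by omega⟩, hd _, hdc⟩)
      have hsum₁ : fv ξ₀ ξ₁ ((ℓ - 1) • c + d) = ℓ * fv ξ₀ ξ₁ c := by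
        rw [hfvdev, hfd]; ring
      have e₁ : (ℓ - 1) • c + d = x := by
        by_contra hne
        have := hxmin _ hy₁ hne
        rw [hsum₁, hxval] at this; exact lt_irrefl _ this
      -- y₂ = 2•d + (ℓ-2)•c via the choice function `f₂`
      let f₂ : Fin ℓ → (Fin 2 →₀ ℕ) := fun i => if (i : ℕ) < 2 then d else c
      have hf₂ : ∀ i, f₂ i ∈ T i := by
        intro i; simp only [f₂]; split_ifs <;> simp [hd i, hc i]
      have hc1 : (Finset.univ.filter fun i : Fin ℓ => (i : ℕ) < 2).card = 2 := by
        have : (Finset.univ.filter fun i : Fin ℓ => (i : ℕ) < 2) =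
            {(⟨0, by omega⟩ : Fin ℓ), ⟨1, by omega⟩} := by
          ext i
          simp only [Finset.mem_filter, Finset.mem_univ, true_and, Finset.mem_insert,
            Finset.mem_singleton, Fin.ext_iff]
          omega
        rw [this, Finset.card_pair]
        exact fun h => absurd (congrArg Fin.val h) (by norm_num)
      have hc2 : (Finset.univ.filter fun i : Fin ℓ => ¬ (i : ℕ) < 2).card = ℓ - 2 := by
        have htot := Finset.card_filter_add_card_filter_not
          (s := (Finset.univ : Finset (Fin ℓ))) (fun i : Fin ℓ => (i : ℕ) < 2)
        rw [hc1, Finset.card_univ, Fintype.card_fin] at htot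
        omega
      have hsumf₂ : ∑ i, f₂ i = 2 • d + (ℓ - 2) • c := by
        simp only [f₂]
        rw [Finset.sum_ite, Finset.sum_const, Finset.sum_const, hc1, hc2]
      have hy₂S : 2 • d + (ℓ - 2) • c ∈ S := by
        rw [← hsumf₂]; exact sum_mem_sumset T f₂ hf₂
      have hsum₂ : fv ξ₀ ξ₁ (2 • d + (ℓ - 2) • c) = ℓ * fv ξ₀ ξ₁ c := by
        rw [fv_add, fv_nsmul, fv_nsmul, hfd, Nat.cast_sub hℓ]
        push_cast; ring
      have hy₂C : 2 • d + (ℓ - 2) • c ≠ C := by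
        intro h
        apply hdc
        ext k
        have hk := congrArg (fun z : Fin 2 →₀ ℕ => z k) h
        simp only [hCdef, Finsupp.add_apply, Finsupp.smul_apply, smul_eq_mul] at hk
        have hℓ' : ℓ * c k = 2 * c k + (ℓ - 2) * c k := by
          rw [← add_mul]; congr 1; omega
        omega
      have hy₂A : 2 • d + (ℓ - 2) • c ∈ S.erase C := Finset.mem_erase.mpr ⟨hy₂C, hy₂S⟩
      have e₂ : 2 • d + (ℓ - 2) • c = x := by
        by_contra hne
        have := hxmin _ hy₂A hne
        rw [hsum₂, hxval] at this; exact lt_irrefl _ this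
      have hne12 : (ℓ - 1) • c + d ≠ 2 • d + (ℓ - 2) • c := by
        intro h
        apply hdc
        ext k
        have hk := congrArg (fun z : Fin 2 →₀ ℕ => z k) h
        simp only [Finsupp.add_apply, Finsupp.smul_apply, smul_eq_mul] at hk
        have hℓ' : (ℓ - 1) * c k = (ℓ - 2) * c k + c k := by
          have : ℓ - 1 = (ℓ - 2) + 1 := by omega
          rw [this, add_mul, one_mul]
        omega
      exact hne12 (e₁.trans e₂.symm)
    by_cases hα0 : 0 < α
    · have hfa : fv ξ₀ ξ₁ a = fv ξ₀ ξ₁ c := by nlinarith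
      exact three a hac ha hfa
    · by_cases hβ0 : 0 < β
      · have hfb : fv ξ₀ ξ₁ b = fv ξ₀ ξ₁ c := by nlinarith
        exact three b hbc hb hfb
      · have hα' : α = 0 := le_antisymm (not_lt.mp hα0) hα
        have hβ' : β = 0 := le_antisymm (not_lt.mp hβ0) hβ
        rw [hα', hβ'] at h0 h1
        apply hi₀
        ext k
        fin_cases k
        · have : ((f i₀) 0 : ℝ) = c 0 := by linarith
          exact_mod_cast this
        · have : ((f i₀) 1 : ℝ) = c 1 := by linarith
          exact_mod_cast this
  · -- Case (b1): `x` beats the summit too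
    left
    refine ⟨hxS, fun e' he' hne => ?_⟩
    rcases eq_or_ne e' C with h | h
    · rw [h]; exact hgt
    · exact hxmin e' (Finset.mem_erase.mpr ⟨h, he'⟩) hne

end

end Summit.ValiantsHypothesis.ValiantsHypothesis.Theorems.NewtonTauWeak.Negative.AlignedPeelingCex
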